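import Summits.QuantumFields.YangMills.Theorems.UnitScaleTiltProp8FlatPortHRows12
import Summits.QuantumFields.YangMills.Theorems.UnitScaleTiltProp8FlatPortDistanceL0
import Summits.QuantumFields.YangMills.Theorems.UnitScaleTiltProp8FlatOpsLettersAssembly
import Summits.QuantumFields.YangMills.Theorems.UnitScaleTiltProp8FlatCubeOperators
import Literature.MathematicalPhysics.QuantumFieldTheory.Balaban1983to89.B6GradLegKLevelV1L0
import HarnessLib

/-!
# Route `UnitScaleTilt`, crux K1 child «MinimiserStabilityRegPr» (stmt-QuantumFields-19200), v8 pillar **P2 `stub_flatOpsCubeSeq`** — THE PORT BRIDGE, file 3: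
# **THE KERNEL ROWS (k1), (k2) OF `FlatOpsHRowsFromKernels.HKernelRows` FOR THE CANONICAL `flatH` AT THE d = 3 CARRIER ARE lit-balaban's
# [Balaban1984PropagatorsII] COROLLARY 2.8 (2.151)₁,₂ (`B6Cor28EntriesKLevelV1L0.cor28_kLevel_H_DH` SHAPE) READ THROUGH THE CHART** — units `c′ = L^{K−n} = η⁻¹`, band
# weights (any positive family: `H` is canonical, `FlatCubeOperators.hOp_eq_hOp`), indicator data `e_c ↔ EuclideanSpace.single c 1 / Pi.single c 1`, the forward
# difference `DV ν c′`, the block length `len(y(b)) = L^{j(b)}`, and the distance `dBI := d_T + 3 ≥ distBI` of file 2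

**LEVEL-0 TWIN** of `UnitScaleTiltProp8FlatPortHRows12` (GAP LIST v22 (P2-L0)): the same statements for lit-balaban's LEVEL-0-ADMITTING torus families
`B6MultiLevelTorusOperatorL0.TDomains` (blocks of every level `0 ≤ j ≤ k` — the P2 text's `Adm22` families have unit cubes `Λ₀ ≠ ∅` in general), obtained from the
gen-17 file by the dictionary swap `B6GlobalChartV1L0.{blkV1, domT}`, `B6Geom246MultiLevel{Box,Torus}L0`, `B6Ineq2142KLevelV1L0.β`, the `…KLevelV1L0` rows of
lit-balaban's S-E port, and `UnitScaleTiltProp8FlatPort*L0`; the `D`-free lemmas of the gen-17 file (`indicator_eq_single`, `toLp_indicator_eq_single`, `cf_ne_zero`) are reused by name, not restated.  Seat `ym3-torus-p1` gen 18.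

Cell `ym3-torus` (HUMAN RULING D-0037, YM ladder rung R3), seat `ym3-torus-p1` gen 17.  `--supports stmt-QuantumFields-19200 --as helper`; count-neutral; def-free.

THE PRINT.  [Balaban1984PropagatorsII] Cor. 2.8 p. 249: *«|H(b,c)|, |(∇H)(b,c)| ≦ O(1)[1, (Lʲη)⁻¹](L^{j′}η)^{−d}e^{−δ₅d(y,c₋)}, b ∈ Δ(y), y ∈ Λ_j, c₋ ∈ Λ_{j′}»* (with the
(2.150) volume weight of the flat entries cancelling `(L^{j′}η)^{−d}`); [Balaban1985Variational] (161)₁ p. 303: *«|HB|, |∇^ηHB| ≦ B₀Σ_c e^{−δ₀d(y₁,c₋)}(L^{j(c)}η)⁻¹|B(c)|»*.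

WHAT IS PROVED (sorry-free; axioms standard; no definition).  At the d = 3 carrier `F = ⟨ℓ+1, hL, m, hm⟩` (so `F.P K ≡ PV 2 ℓ m K`), heights `n, K` with
`k = K − n`, a torus family `D : TDomains 2 ℓ M_h (K−n) P′ R` charted by `hN`, ANY positive weight family `w♯` on the index bonds and the units `c′ = L^{K−n}`:
* §1 `toLp_indicator_eq_single`, `indicator_eq_single` (the P2 text's decidability-free indicators ARE the coordinate vectors), **`flatH_apply_eq`** (the canonical
  `flatH F n K (domT hN D hk) e b` IS the port's `(GE ∘ QsE ∘ EE)_{w♯,c′} (single c 1) b`, by `hOp_eq_hOp`), `levWeight_one_eq` (`w 1 b = L^{j(b)}/c′` with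
  `j(b) = D.lev (toBox b₋)`), `len_blkV1_eq`;
* §2 **`hRows12_of_cor28Shape`**: IF the two displayed conclusions of `cor28_kLevel_H_DH` hold for `domT hN D hk` with constants `(C, δ)` (hypotheses `h₁`, `h₂`, verbatim
  shapes), THEN for every P2 weight family `w` (`IsLevWeight`), every index bond `c`, indicator `e_c` and fine bond `b`:
  (k1) `|(flatH e_c)(b)| ≤ C·e^{3δ}·e^{−δ·(d_T(y(b), β c) + 3)}` and (k2) `(L^{j(b)}η)·η⁻¹·|(flatH e_c)(b + e_ν) − (flatH e_c)(b)| ≤ C·e^{3δ}·e^{−δ·(d_T + 3)}` —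
  rows (k1), (k2) of `HKernelRows F n K (domT hN D hk) (d_T + 3) w (flatH …) (C·e^{3δ}) δ` with the file-2 distance `dBI := d_T + 3 ≥ distBI`.
The hypotheses are supplied hypothesis-free by `B6Cor28EntriesKLevelV1L0.cor28_kLevel_H_DH` (odd `L ≥ 5`, `k ≥ 2`, `M_h = Lᵃ ≥ 8`, `R ≥ 2L²`, `P′ ≥ 5`, all cubes placed —
`placed_all_cubes` at `L = 5`, or after padding `B6PadLevelV1` at every odd `L ≥ 5`; file 4 of this bridge).  HONEST SCOPE: translation only; NOT a claim about the mass gap.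

References: T. Bałaban, CMP **96** (1984) 223–250 [Balaban1984PropagatorsII] (2.35) p.228, Cor. 2.8 (2.150)–(2.151) p.249; CMP **102** (1985) 277–309 [Balaban1985Variational]
(45)–(46) p.285, (157) p.302, (161) p.303.
-/

set_option autoImplicit false

noncomputable section

open scoped BigOperators

namespace Summit.QuantumFields.YangMills.Theorems.FlatPortHRows12L0

open FlatPortHRows12 (indicator_eq_single toLp_indicator_eq_single cf_ne_zero)

open Literature.MathematicalPhysics.QuantumFieldTheory.Balaban1983to89
open Literature.MathematicalPhysics.QuantumFieldTheory.BalabanImbrieJaffe1984to88.BIJ85AxialPropagator411 (BondSpace)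
open B5Eq118OneStroke (iterBlockOf)
open B6MultiLevelBoxOperator (N0)
open B6MultiLevelTorusOperatorL0 (TDomains)
open B6Geom246MultiLevelBoxL0 (bset)
open B6Geom246MultiLevelTorusL0 (geomT bondT)
open B6GlobalChartV1 (PV toBox)
open B6GlobalChartV1L0 (blkV1 domT)
open B6Ineq2142KLevelV1L0 (β)
open B6Ineq2133TwoScaleV1 (onFun onFun_apply)
open B6GradLegKLevelV1 (DV DV_apply)
open B6SectADomainsV1 (Domains)
open B6SectAOperatorsV1 (BondIdx BondIdxSpace QsE)
open B6SectAVectorModelV1 (GE EE)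
open B6SectA (hOp)
open B11Eq115Space (levOf)
open T3ContinuumYM3Torus (T3Family)
open FlatCubeOpsText (IsLevWeight distBI)
open FlatOpsLettersAssembly (flatH)
open FlatPortDistanceL0 (levOf_domT blkV1_level distBI_domT_le)

/-! ## §1 Dictionary: indicators, the canonical `H`, the level weight and the block length -/

section Carrier

variable (ℓ : ℕ) (hL : Odd (ℓ + 1) ∧ 1 < ℓ + 1) (m : ℕ) (hm : 1 ≤ m) (n K : ℕ)
variable {Mh R : ℕ} {P' : Fin (2 + 1) → ℕ}
variable (hN : ∀ μ, N0 ℓ Mh (K - n) P' μ = (PV 2 ℓ m K (by norm_num) hL).sitesPerDir 0) (D : TDomains 2 ℓ Mh (K - n) P' R) (hk : K - n ≤ m + K)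

/-- **THE CANONICAL `flatH` IS THE PORT's `H = GE ∘ QsE ∘ EE` WITH ANY POSITIVE WEIGHTS**, read against the coordinate vector (`hOp_eq_hOp`: `H` does not depend on the
auxiliary weights; the units of `flatH` are `c′ = L^{K−n}`). [cite: Balaban1984PropagatorsII, (2.35) p.228; Balaban1985Variational, (45) p.285, (157) p.302] -/
theorem flatH_apply_eq {w' : BondIdx (B6GlobalChartV1L0.domT (hd := by norm_num) hN D hk) → ℝ} (hw' : ∀ i, 0 < w' i)
    {c : BondIdx (domT (hd := by norm_num) hN D hk)} {e : BondIdx (domT (hd := by norm_num) hN D hk) → ℝ} (he : e c = 1) (he' : ∀ c', c' ≠ c → e c' = 0)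
    (b : PBond (PV 2 ℓ m K (by norm_num) hL) 0) :
    flatH (⟨ℓ + 1, hL, m, hm⟩ : T3Family) n K (domT (hd := by norm_num) hN D hk) e b =
      (GE (domT (hd := by norm_num) hN D hk) (cf_ne_zero ℓ n K) hw' ∘ₗ QsE (domT (hd := by norm_num) hN D hk) ∘ₗ
        EE (domT (hd := by norm_num) hN D hk) (cf_ne_zero ℓ n K) hw') (EuclideanSpace.single c (1 : ℝ)) b := by
  have h0 : flatH (⟨ℓ + 1, hL, m, hm⟩ : T3Family) n K (domT (hd := by norm_num) hN D hk) e b =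
      hOp (GE (domT (hd := by norm_num) hN D hk) (cf_ne_zero ℓ n K) (fun _ => one_pos) (w := fun _ => (1 : ℝ)))
        (QsE (domT (hd := by norm_num) hN D hk)) (EE (domT (hd := by norm_num) hN D hk) (cf_ne_zero ℓ n K) (fun _ => one_pos) (w := fun _ => (1 : ℝ)))
        (WithLp.toLp 2 e) b := rfl
  rw [h0, FlatCubeOperators.hOp_eq_hOp (domT (hd := by norm_num) hN D hk) (cf_ne_zero ℓ n K) (fun _ => one_pos) hw' (WithLp.toLp 2 e),
    toLp_indicator_eq_single he he']
  rfl

/-- **THE LEVEL WEIGHT** of the P2 text at the charted family: `w 1 b = L^{j(b)}·L^{−(K−n)}` with `j(b) = D.lev (toBox b₋)`. [cite: Balaban1985Variational, p.286, (115) p.294] -/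
theorem levWeight_one_eq {w : ℕ → PBond (PV 2 ℓ m K (by norm_num) hL) 0 → ℝ}
    (hw : IsLevWeight (⟨ℓ + 1, hL, m, hm⟩ : T3Family) n K (B6GlobalChartV1L0.domT (hd := by norm_num) hN D hk) w) (b : PBond (PV 2 ℓ m K (by norm_num) hL) 0) :
    w 1 b = (((ℓ + 1 : ℕ) : ℝ)) ^ D.lev (toBox hN b.src : Fin (2 + 1) → ℤ) * ((((ℓ + 1 : ℕ) : ℝ))⁻¹) ^ (K - n) := by
  rw [hw 1 b, pow_one]
  have hlev := levOf_domT (hd := by norm_num) hN D hk b.src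
  show ((((⟨ℓ + 1, hL, m, hm⟩ : T3Family).L : ℕ) : ℝ)) ^ levOf (fun j => {x : Site (PV 2 ℓ m K (by norm_num) hL) 0 | (domT (hd := by norm_num) hN D hk).InOm j x}) (K - n) b.src *
      (((((⟨ℓ + 1, hL, m, hm⟩ : T3Family).L : ℕ) : ℝ))⁻¹) ^ (K - n) = _
  rw [hlev]

/-- the block length of the lineage at the block of a fine bond: `len(y(b)) = L^{j(b)}` (`η = 1` in `geomT`). [cite: Balaban1984PropagatorsII, (2.46) p.231, dictionary] -/
theorem len_blkV1_eq (b : PBond (PV 2 ℓ m K (by norm_num) hL) 0) :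
    (geomT D).len (B6GlobalChartV1L0.blkV1 hN D b) = (((ℓ + 1 : ℕ) : ℝ)) ^ D.lev (toBox hN b.src : Fin (2 + 1) → ℤ) := by
  show ((ℓ : ℝ) + 1) ^ (blkV1 hN D b).1.1 * 1 = _
  rw [mul_one, blkV1_level]
  push_cast
  ring

end Carrier

/-! ## §2 Rows (k1), (k2) from the Corollary 2.8 shape -/

section Rows

variable (ℓ : ℕ) (hL : Odd (ℓ + 1) ∧ 1 < ℓ + 1) (m : ℕ) (hm : 1 ≤ m) (n K : ℕ)
variable {Mh R : ℕ} {P' : Fin (2 + 1) → ℕ}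
variable (hN : ∀ μ, N0 ℓ Mh (K - n) P' μ = (PV 2 ℓ m K (by norm_num) hL).sitesPerDir 0) (D : TDomains 2 ℓ Mh (K - n) P' R) (hk : K - n ≤ m + K)

/-- **ROWS (k1), (k2) OF `HKernelRows` FROM THE COROLLARY 2.8 SHAPE.**  Hypotheses: the two conclusions of `B6Cor28EntriesKLevelV1L0.cor28_kLevel_H_DH` for the family
`domT hN D hk` at units `c′ = L^{K−n}`, some positive weights `w♯`, constants `C`, `δ` (verbatim shapes `h₁`, `h₂`); `M_h ≥ 1`, `P′ ≥ 1`.  Conclusion: for every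
P2 weight family `w`, index bond `c`, indicator `e_c`, fine bond `b`, with `d := d_T(y(b), β c)`:
`|(flatH e_c)(b)| ≤ Ce^{3δ}·e^{−δ(d + 3)}` and `w₁(b)·L^{K−n}·|(flatH e_c)(b + e_ν) − (flatH e_c)(b)| ≤ Ce^{3δ}·e^{−δ(d + 3)}` — i.e. (k1), (k2) over the distance `d_T + 3`
(which dominates `distBI`, `FlatPortDistanceL0.distBI_domT_le`). [cite: Balaban1984PropagatorsII, Cor. 2.8 (2.150)-(2.151) p.249; Balaban1985Variational, (161) p.303] -/
theorem hRows12_of_cor28Shape {ws : BondIdx (B6GlobalChartV1L0.domT (hd := by norm_num) hN D hk) → ℝ} (hws : ∀ i, 0 < ws i) {C δ : ℝ}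
    (h₁ : ∀ (c : BondIdx (domT (hd := by norm_num) hN D hk)) (f : PBond (PV 2 ℓ m K (by norm_num) hL) 0),
      |(GE (domT (hd := by norm_num) hN D hk) (cf_ne_zero ℓ n K) hws ∘ₗ QsE (domT (hd := by norm_num) hN D hk) ∘ₗ
          EE (domT (hd := by norm_num) hN D hk) (cf_ne_zero ℓ n K) hws) (EuclideanSpace.single c (1 : ℝ)) f| ≤
        C * Real.exp (-(δ * (geomT D).dist (blkV1 hN D f) (β hN D hk c))))
    (h₂ : ∀ (ν : Fin (2 + 1)) (c : BondIdx (domT (hd := by norm_num) hN D hk)) (f : PBond (PV 2 ℓ m K (by norm_num) hL) 0),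
      |(DV ν ((((ℓ + 1 : ℕ) : ℝ)) ^ (K - n)) ∘ₗ onFun (GE (domT (hd := by norm_num) hN D hk) (cf_ne_zero ℓ n K) hws ∘ₗ QsE (domT (hd := by norm_num) hN D hk) ∘ₗ
          EE (domT (hd := by norm_num) hN D hk) (cf_ne_zero ℓ n K) hws)) (Pi.single c 1) f| ≤
        C * ((geomT D).len (blkV1 hN D f) * |(((ℓ + 1 : ℕ) : ℝ)) ^ (K - n)|⁻¹)⁻¹ * Real.exp (-(δ * (geomT D).dist (blkV1 hN D f) (β hN D hk c))))
    (w : ℕ → PBond (PV 2 ℓ m K (by norm_num) hL) 0 → ℝ) (hw : IsLevWeight (⟨ℓ + 1, hL, m, hm⟩ : T3Family) n K (domT (hd := by norm_num) hN D hk) w)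
    (c : BondIdx (domT (hd := by norm_num) hN D hk)) (e : BondIdx (domT (hd := by norm_num) hN D hk) → ℝ) (he : e c = 1) (he' : ∀ c', c' ≠ c → e c' = 0)
    (b : PBond (PV 2 ℓ m K (by norm_num) hL) 0) :
    |flatH (⟨ℓ + 1, hL, m, hm⟩ : T3Family) n K (domT (hd := by norm_num) hN D hk) e b| ≤
        C * Real.exp (3 * δ) * Real.exp (-(δ * (((bondT D).dist (blkV1 hN D b) (β hN D hk c) : ℝ) + 3))) ∧
      ∀ ν : Fin (2 + 1), w 1 b * (((ℓ + 1 : ℕ) : ℝ)) ^ (K - n) *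
          |flatH (⟨ℓ + 1, hL, m, hm⟩ : T3Family) n K (domT (hd := by norm_num) hN D hk) e ⟨b.src.shift ν, b.dir⟩ -
            flatH (⟨ℓ + 1, hL, m, hm⟩ : T3Family) n K (domT (hd := by norm_num) hN D hk) e b| ≤
        C * Real.exp (3 * δ) * Real.exp (-(δ * (((bondT D).dist (blkV1 hN D b) (β hN D hk c) : ℝ) + 3))) := by
  set cf : ℝ := (((ℓ + 1 : ℕ) : ℝ)) ^ (K - n) with hcf
  set dT : ℝ := ((bondT D).dist (blkV1 hN D b) (β hN D hk c) : ℝ) with hdT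
  have hL0 : (0 : ℝ) < ((ℓ + 1 : ℕ) : ℝ) := by exact_mod_cast Nat.succ_pos ℓ
  have hcf0 : 0 < cf := pow_pos hL0 _
  -- the exponential bookkeeping: `e^{−δd} = e^{3δ}·e^{−δ(d+3)}`
  have hexp : Real.exp (-(δ * dT)) = Real.exp (3 * δ) * Real.exp (-(δ * (dT + 3))) := by
    rw [← Real.exp_add]; congr 1; ring
  have hdist : (geomT D).dist (blkV1 hN D b) (β hN D hk c) = dT := rfl
  refine ⟨?_, fun ν => ?_⟩
  · -- (k1)
    rw [flatH_apply_eq ℓ hL m hm n K hN D hk hws he he' b]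
    have h := h₁ c b
    rw [hdist, hexp, ← mul_assoc] at h
    exact h
  · -- (k2): the port's `DV ν c′ (onFun H) (Pi.single c 1) b = c′·((flatH e)(b + e_ν) − (flatH e)(b))`
    have hH : ∀ b' : PBond (PV 2 ℓ m K (by norm_num) hL) 0,
        onFun (GE (domT (hd := by norm_num) hN D hk) (cf_ne_zero ℓ n K) hws ∘ₗ QsE (domT (hd := by norm_num) hN D hk) ∘ₗ
            EE (domT (hd := by norm_num) hN D hk) (cf_ne_zero ℓ n K) hws) (Pi.single c 1) b' =
          flatH (⟨ℓ + 1, hL, m, hm⟩ : T3Family) n K (domT (hd := by norm_num) hN D hk) e b' := by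
      intro b'
      rw [onFun_apply, ← indicator_eq_single he he', flatH_apply_eq ℓ hL m hm n K hN D hk hws he he' b', toLp_indicator_eq_single he he']
    have h := h₂ ν c b
    rw [LinearMap.comp_apply, DV_apply, hH, hH, hdist, hexp, len_blkV1_eq ℓ hL m n K hN D] at h
    rw [levWeight_one_eq ℓ hL m hm n K hN D hk hw b]
    -- units: `w₁·c′ = L^{j(b)}`, and the port's prefactor is `c′·L^{−j(b)}`
    set Lj : ℝ := (((ℓ + 1 : ℕ) : ℝ)) ^ D.lev (toBox hN b.src : Fin (2 + 1) → ℤ) with hLj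
    have hLj0 : 0 < Lj := pow_pos hL0 _
    have hw1 : Lj * ((((ℓ + 1 : ℕ) : ℝ))⁻¹) ^ (K - n) * cf = Lj := by
      rw [hcf, inv_pow]; field_simp
    rw [hw1]
    have habs : |cf| = cf := abs_of_pos hcf0
    rw [habs] at h
    -- `h : |c′·diff| ≤ C·(Lj·c′⁻¹)⁻¹·(e^{3δ}e^{−δ(d+3)})`
    rw [abs_mul, habs] at h
    have hpre : (Lj * cf⁻¹)⁻¹ = cf * Lj⁻¹ := by rw [mul_inv, inv_inv, mul_comm]
    rw [hpre] at h
    -- divide by `c′` and multiply by `Lj`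
    have h' : cf * (Lj * |flatH (⟨ℓ + 1, hL, m, hm⟩ : T3Family) n K (domT (hd := by norm_num) hN D hk) e ⟨b.src.shift ν, b.dir⟩ -
          flatH (⟨ℓ + 1, hL, m, hm⟩ : T3Family) n K (domT (hd := by norm_num) hN D hk) e b|) ≤
        cf * (C * Real.exp (3 * δ) * Real.exp (-(δ * (dT + 3)))) := by
      calc cf * (Lj * |flatH (⟨ℓ + 1, hL, m, hm⟩ : T3Family) n K (domT (hd := by norm_num) hN D hk) e ⟨b.src.shift ν, b.dir⟩ -
            flatH (⟨ℓ + 1, hL, m, hm⟩ : T3Family) n K (domT (hd := by norm_num) hN D hk) e b|)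
          = Lj * (cf * |flatH (⟨ℓ + 1, hL, m, hm⟩ : T3Family) n K (domT (hd := by norm_num) hN D hk) e ⟨b.src.shift ν, b.dir⟩ -
            flatH (⟨ℓ + 1, hL, m, hm⟩ : T3Family) n K (domT (hd := by norm_num) hN D hk) e b|) := by ring
        _ ≤ Lj * (C * (cf * Lj⁻¹) * (Real.exp (3 * δ) * Real.exp (-(δ * (dT + 3))))) := mul_le_mul_of_nonneg_left h hLj0.le
        _ = cf * (C * Real.exp (3 * δ) * Real.exp (-(δ * (dT + 3)))) := by field_simp
    exact le_of_mul_le_mul_left h' hcf0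

end Rows

end Summit.QuantumFields.YangMills.Theorems.FlatPortHRows12L0

end
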